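import Summits.QuantumFields.YangMills.Theorems.BalabanUVNodesN15KingModelCombesThomasLocality
import Summits.QuantumFields.YangMills.Theorems.BalabanUVNodesN15KingModelCombesThomasFormLipschitz
import HarnessLib

/-!
# BalabanUVNodes ∕ N15 — THE KING-MODEL RUNG (PART Ϧ-k): THE SUPPORT OF `A₀(U) − A₀(V)` FROM THE BONDS WHERE THE FIELDS DIFFER — rows∕columns of the hopping difference vanish at sites
# all of whose bonds agree, rows∕columns of the block-term difference vanish on blocks all of whose based bonds agree; hence CHANGING THE LINK FIELD ONLY NEAR `Z` CHANGES `blk G x y` BY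
# `O(e^{−ctRate·(R_x+R_y)∕L})` (`R_x ≤ d(x,Z)`, `R_y ≤ d(Z,y)`) — PART Ϧ-i's locality theorem with its support hypothesis DISCHARGED from the fields
# (Track A, DAG node N15 = NE2; FAN-OUT v1.1 §N15 s3 «KING-MODEL RUNG … + what the curved case adds»; count-neutral)

HONEST FRAMING.  Count-neutral (cell `pub-ymgap`, seat `pub-ymgap-dag-n15-e` g50; `--supports stmt-QuantumFields-27247 --as helper` = K3ᴬ, KEY MAP v3).  King's one-level comparison model, King's
scaling, two unitary link fields; `Z` any set of fine sites OUTSIDE which every site has all its bonds (forward, backward, and all bonds based in its block) equal for `U` and `V`.  The mass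
is the honest `ℓ²` quantity `|Z|²·‖A₀(U) − A₀(V)‖ ≤ |Z|²·4((d+1)L² + aD)` (crude).  NOT Bałaban's (3.48)–(3.50); NOT a node discharge; nothing continuum ∕ ℝ⁴ ∕ OS ∕ Clay.

THE RESULTS (`T` a tree contour system of depth `≤ D`, `M` the block torus; `δA = A₀(U) − A₀(V)` in King's scaling):
* §1 `blk_covLapF_sub_eq_zero_row`∕`_col` — if `U(z,μ) = V(z,μ)` and `U(z−e_μ,μ) = V(z−e_μ,μ)` for all `μ`, the row AND the column `z` of `blk((−cΔ_U+m²) − (−cΔ_V+m²))` vanish;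
  `blk_gram_sub_eq_zero_row`∕`_col` — if `U = V` on every bond based in the block of `x`, the row and the column `x` of `blk(Q(U)ᴴQ(U) − Q(V)ᴴQ(V))` vanish (Ϥ-b `treeHol_congr_block`);
  ★ `blk_fullOpU_sub_eq_zero_of_agree` — the support of `δA` lies in `Z × Z`.
* §2 `l2_opNorm_fullOpU_sub_le_crude` (`‖δA‖ ≤ 4((d+1)L² + aD)` for any two unitary fields), ★★★ **`norm_blk_fullOpU_inv_sub_le_of_agree_off`** — both `A₀` `κ`-coercive, `U = V` (in the above sense)
  off `Z`, `R_x ≤ d(x,z)`, `R_y ≤ d(z,y)` on `Z` ⟹ `‖blk (G(U) − G(V)) x y‖ ≤ (2∕κ)²·|Z|²·4((d+1)L² + aD)·e^{−ctRate·R_x∕L}·e^{−ctRate·R_y∕L}` (every `L ≥ 1`, volume, fibre).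
PRIOR TREE ART (by name): Ϧ-i (`norm_blk_fullOpU_inv_sub_le_of_support_opNorm`), Ϧ-f (`blk_gram_covQ_site`, `l2_opNorm_wtConj_fullOpU_sub_le`), Ϧ-h (`wtConj_ctW_zero`), Ͱ-n (`blk_hop_sub_hop`, `covLapF_eq`, `blk_sub'`),
Ϥ-b (`treeHol_congr_block`), Ͱ-q (`l2_opNorm_of_mem_unitaryGroup_le`), `King1986.Torus` (`site`, `blockOf`, `blockEquiv`).  Dedup (rg at filing): basename 0 files; needles `blk_covLapF_sub_eq_zero_row|
blk_gram_sub_eq_zero_row|blk_fullOpU_sub_eq_zero_of_agree|norm_blk_fullOpU_inv_sub_le_of_agree_off` 0 tree files.  Locators: [King1986] (4.33)–(4.34) p.674; [Balaban1985BackgroundPropagators] (3.23)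
p.394, (3.19) p.393, (3.39) p.397 (shape).  0 `sorry`, 0 `def`.
-/

noncomputable section
open scoped BigOperators ComplexConjugate ComplexOrder InnerProductSpace Matrix.Norms.L2Operator
open Finset Matrix WithLp

namespace Summit.QuantumFields.YangMills.BalabanUVNodes.N15KingModelRung.CombesThomas

open Literature.MathematicalPhysics.QuantumFieldTheory.LatticeDiamagneticInequality (blk)
open Literature.MathematicalPhysics.QuantumFieldTheory.Balaban1983to89.B5Prop11Plancherel (Tor fine unitVec)
open Literature.MathematicalPhysics.QuantumFieldTheory.King1986.Torus (site blockOf blockOf_site blockEquiv blockEquiv_apply ctW tdistT)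
open Summit.QuantumFields.YangMills.BalabanUVNodes.N15KingModelRung.Covariant (covLapF covLapF_eq kingHopping fib blk_hop_sub_hop blk_sub' l2_opNorm_of_mem_unitaryGroup_le)
open Summit.QuantumFields.YangMills.BalabanUVNodes.N15KingModelRung.CovariantBlock (BlockTree covQ fullOpU treeHol treeHol_congr_block)

variable {d : ℕ}
variable {𝕜 : Type*} [RCLike 𝕜] {n : Type*} [Fintype n] [DecidableEq n]

/-! ## §1 Where the difference of the two full operators lives -/

section Support

variable {L : ℕ} [NeZero L] (T : BlockTree d L) (M : Fin (d + 1) → ℕ) [hM : ∀ μ, NeZero (M μ)]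

omit [Fintype n] in
/-- ROWS of the hopping difference vanish at a site all of whose bonds agree. [cite: Balaban1985BackgroundPropagators, (3.23) p.394] -/
theorem blk_covLapF_sub_eq_zero_row {K : Fin (d + 1) → ℕ} [∀ μ, NeZero (K μ)] (c m2 : ℝ) {U V : Tor K × Fin (d + 1) → Matrix n n 𝕜} {z : Tor K}
    (h1 : ∀ μ, U (z, μ) = V (z, μ)) (h2 : ∀ μ, U (z - unitVec K μ, μ) = V (z - unitVec K μ, μ)) (w : Tor K) :
    blk (covLapF K c m2 U - covLapF K c m2 V) z w = 0 := by
  have hdiff : covLapF K c m2 U - covLapF K c m2 V = (kingHopping K c m2).hop V - (kingHopping K c m2).hop U := by rw [covLapF_eq, covLapF_eq]; abel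
  rw [hdiff, blk_hop_sub_hop]
  refine (congrArg _ (Finset.sum_eq_zero fun μ _ => ?_)).trans (smul_zero _)
  rw [h1 μ, h2 μ, sub_self, sub_self, conjTranspose_zero, ite_self, ite_self, add_zero]

omit [Fintype n] in
/-- COLUMNS of the hopping difference vanish at a site all of whose bonds agree. [cite: Balaban1985BackgroundPropagators, (3.23) p.394] -/
theorem blk_covLapF_sub_eq_zero_col {K : Fin (d + 1) → ℕ} [∀ μ, NeZero (K μ)] (c m2 : ℝ) {U V : Tor K × Fin (d + 1) → Matrix n n 𝕜} {w : Tor K}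
    (h1 : ∀ μ, U (w, μ) = V (w, μ)) (h2 : ∀ μ, U (w - unitVec K μ, μ) = V (w - unitVec K μ, μ)) (z : Tor K) :
    blk (covLapF K c m2 U - covLapF K c m2 V) z w = 0 := by
  have hdiff : covLapF K c m2 U - covLapF K c m2 V = (kingHopping K c m2).hop V - (kingHopping K c m2).hop U := by rw [covLapF_eq, covLapF_eq]; abel
  rw [hdiff, blk_hop_sub_hop]
  refine (congrArg _ (Finset.sum_eq_zero fun μ _ => ?_)).trans (smul_zero _)
  have a1 : (if w = z + unitVec K μ then V (z, μ) - U (z, μ) else 0) = 0 := by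
    by_cases h : w = z + unitVec K μ
    · have hz : z = w - unitVec K μ := by rw [h, add_sub_cancel_right]
      rw [if_pos h, hz, h2 μ, sub_self]
    · rw [if_neg h]
  have a2 : (if w = z - unitVec K μ then (V (z - unitVec K μ, μ) - U (z - unitVec K μ, μ))ᴴ else 0) = 0 := by
    by_cases h : w = z - unitVec K μ
    · rw [if_pos h, ← h, h1 μ, sub_self, conjTranspose_zero]
    · rw [if_neg h]
  rw [a1, a2, add_zero]

/-- ROWS AND COLUMNS of the block-term difference vanish on a block all of whose based bonds agree: if `U = V` on every bond `(x′, μ)` with `x′` in the block of `x`, then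
`blk (Q(U)ᴴQ(U) − Q(V)ᴴQ(V)) x x′ = 0` and `blk (…) x′ x = 0` for all `x′`. [cite: Balaban1985BackgroundPropagators, (3.19) p.393] -/
theorem blk_gram_sub_eq_zero_row_col {U V : Tor (fine L M) × Fin (d + 1) → Matrix n n 𝕜} {x : Tor (fine L M)}
    (h : ∀ bd : Tor (fine L M) × Fin (d + 1), blockOf L M bd.1 = blockOf L M x → U bd = V bd) (x' : Tor (fine L M)) :
    blk ((covQ T M U)ᴴ * covQ T M U - (covQ T M V)ᴴ * covQ T M V) x x' = 0 ∧ blk ((covQ T M U)ᴴ * covQ T M U - (covQ T M V)ᴴ * covQ T M V) x' x = 0 := by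
  obtain ⟨⟨β, j⟩, rfl⟩ := (blockEquiv L M).surjective x
  obtain ⟨⟨β', j'⟩, rfl⟩ := (blockEquiv L M).surjective x'
  simp only [blockEquiv_apply, blockOf_site] at h ⊢
  have hhol : ∀ k, treeHol M T U β k = treeHol M T V β k := treeHol_congr_block T M β fun k _ => h _ (blockOf_site L M β _)
  constructor
  · rw [blk_sub', blk_gram_covQ_site, blk_gram_covQ_site]
    by_cases hb : β = β'
    · subst hb; rw [if_pos rfl, if_pos rfl, hhol, hhol, sub_self]
    · rw [if_neg hb, if_neg hb, sub_self]
  · rw [blk_sub', blk_gram_covQ_site, blk_gram_covQ_site]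
    by_cases hb : β' = β
    · subst hb; rw [if_pos rfl, if_pos rfl, hhol, hhol, sub_self]
    · rw [if_neg hb, if_neg hb, sub_self]

/-- ★ **THE SUPPORT OF `A₀(U) − A₀(V)`**: if outside `Z` every site has all its bonds (forward, backward) and all bonds based in its block equal for `U` and `V`, then
`blk (A₀(U) − A₀(V)) z z′ = 0` unless `z ∈ Z` and `z′ ∈ Z`. [cite: Balaban1985BackgroundPropagators, (3.23)–(3.24) p.394] -/
theorem blk_fullOpU_sub_eq_zero_of_agree (a c m2 : ℝ) {U V : Tor (fine L M) × Fin (d + 1) → Matrix n n 𝕜} (Z : Finset (Tor (fine L M)))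
    (hZ : ∀ z, z ∉ Z → (∀ μ, U (z, μ) = V (z, μ)) ∧ (∀ μ, U (z - unitVec (fine L M) μ, μ) = V (z - unitVec (fine L M) μ, μ))
      ∧ (∀ bd : Tor (fine L M) × Fin (d + 1), blockOf L M bd.1 = blockOf L M z → U bd = V bd))
    (z z' : Tor (fine L M)) (hzz : z ∉ Z ∨ z' ∉ Z) : blk (fullOpU T M a c m2 U - fullOpU T M a c m2 V) z z' = 0 := by
  have hsplit : fullOpU T M a c m2 U - fullOpU T M a c m2 V = (covLapF (fine L M) c m2 U - covLapF (fine L M) c m2 V)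
      + ((a * (L : ℝ) ^ (d + 1) : ℝ) : 𝕜) • ((covQ T M U)ᴴ * covQ T M U - (covQ T M V)ᴴ * covQ T M V) := by
    rw [fullOpU, fullOpU, smul_sub]; abel
  have hblk : blk (fullOpU T M a c m2 U - fullOpU T M a c m2 V) z z' = blk (covLapF (fine L M) c m2 U - covLapF (fine L M) c m2 V) z z'
      + ((a * (L : ℝ) ^ (d + 1) : ℝ) : 𝕜) • blk ((covQ T M U)ᴴ * covQ T M U - (covQ T M V)ᴴ * covQ T M V) z z' := by
    rw [hsplit]; ext i k; simp only [blk, Matrix.of_apply, Matrix.add_apply, Matrix.smul_apply, smul_eq_mul]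
  rw [hblk]
  rcases hzz with hz | hz'
  · obtain ⟨h1, h2, h3⟩ := hZ z hz
    rw [blk_covLapF_sub_eq_zero_row c m2 h1 h2, (blk_gram_sub_eq_zero_row_col T M h3 z').1, smul_zero, add_zero]
  · obtain ⟨h1, h2, h3⟩ := hZ z' hz'
    rw [blk_covLapF_sub_eq_zero_col c m2 h1 h2, (blk_gram_sub_eq_zero_row_col T M h3 z).2, smul_zero, add_zero]

end Support

/-! ## §2 Locality from the fields -/

section Locality

variable {L : ℕ} [NeZero L] (T : BlockTree d L) (M : Fin (d + 1) → ℕ) [hM : ∀ μ, NeZero (M μ)]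

/-- A crude size of `A₀(U) − A₀(V)` for ANY two unitary fields (King's scaling, contours of depth `≤ D`): `‖A₀(U) − A₀(V)‖ ≤ 4((d+1)L² + aD)` (PART Ϧ-f with `ε = 2`, zero weight). [folklore] -/
theorem l2_opNorm_fullOpU_sub_le_crude {D : ℕ} (hD : ∀ j, T.depth j ≤ D) {a : ℝ} (ha : 0 ≤ a) (m2 : ℝ) {U V : Tor (fine L M) × Fin (d + 1) → Matrix n n 𝕜}
    (hU : ∀ bd, U bd ∈ Matrix.unitaryGroup n 𝕜) (hV : ∀ bd, V bd ∈ Matrix.unitaryGroup n 𝕜) :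
    ‖fullOpU T M a ((L : ℝ) ^ 2) m2 U - fullOpU T M a ((L : ℝ) ^ 2) m2 V‖ ≤ 4 * (((d : ℝ) + 1) * (L : ℝ) ^ 2 + a * D) := by
  have hε : ∀ bd, ‖U bd - V bd‖ ≤ 2 := fun bd =>
    (norm_sub_le _ _).trans (by linarith [l2_opNorm_of_mem_unitaryGroup_le (hU bd), l2_opNorm_of_mem_unitaryGroup_le (hV bd)])
  have h := l2_opNorm_wtConj_fullOpU_sub_le T M hD ha (by positivity : (0 : ℝ) ≤ (L : ℝ) ^ 2) m2 hU hV zero_le_two hε le_rfl (0 : Tor (fine L M))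
  rw [wtConj_ctW_zero, zero_div, Real.exp_zero, one_mul, one_mul] at h
  refine h.trans (le_of_eq (by ring))

/-- ★★★ **LOCALITY FROM THE FIELDS**: two unitary fields, both `A₀` `κ`-coercive (King's scaling, contours of depth `≤ D`, `a ≥ 0`, `L ≥ 1`), and a set `Z` of sites outside which every site has all
its bonds and all bonds based in its block equal for `U` and `V`; if `R_x ≤ d(x,z)` and `R_y ≤ d(z′,y)` for all `z, z′ ∈ Z` then
`‖blk (G(U) − G(V)) x y‖ ≤ (2∕κ)²·(|Z|²·4((d+1)L² + aD))·e^{−ctRate·R_x∕L}·e^{−ctRate·R_y∕L}` — changing the background away from `x` and `y` changes `G(x,y)` exponentially little, at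
an `η`-uniform rate. [cite: King1986, (4.33)–(4.34) p.674; Balaban1985BackgroundPropagators, (3.39) p.397 (shape)] -/
theorem norm_blk_fullOpU_inv_sub_le_of_agree_off (hL : 1 ≤ L) {D : ℕ} (hD : ∀ j, T.depth j ≤ D) {a : ℝ} (ha : 0 ≤ a) (m2 : ℝ)
    {U V : Tor (fine L M) × Fin (d + 1) → Matrix n n 𝕜} (hU : ∀ bd, U bd ∈ Matrix.unitaryGroup n 𝕜) (hV : ∀ bd, V bd ∈ Matrix.unitaryGroup n 𝕜) {κ : ℝ} (hκ : 0 < κ)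
    (hcoU : ∀ v : Tor (fine L M) × n → 𝕜, κ * ∑ x, ‖fib (fine L M) v x‖ ^ 2 ≤ RCLike.re (star v ⬝ᵥ (fullOpU T M a ((L : ℝ) ^ 2) m2 U *ᵥ v)))
    (hcoV : ∀ v : Tor (fine L M) × n → 𝕜, κ * ∑ x, ‖fib (fine L M) v x‖ ^ 2 ≤ RCLike.re (star v ⬝ᵥ (fullOpU T M a ((L : ℝ) ^ 2) m2 V *ᵥ v)))
    (Z : Finset (Tor (fine L M)))
    (hZ : ∀ z, z ∉ Z → (∀ μ, U (z, μ) = V (z, μ)) ∧ (∀ μ, U (z - unitVec (fine L M) μ, μ) = V (z - unitVec (fine L M) μ, μ))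
      ∧ (∀ bd : Tor (fine L M) × Fin (d + 1), blockOf L M bd.1 = blockOf L M z → U bd = V bd))
    (x y : Tor (fine L M)) {Rx Ry : ℝ} (hRx : ∀ z ∈ Z, Rx ≤ tdistT (fine L M) x z) (hRy : ∀ z' ∈ Z, Ry ≤ tdistT (fine L M) z' y) :
    ‖blk ((fullOpU T M a ((L : ℝ) ^ 2) m2 U)⁻¹ - (fullOpU T M a ((L : ℝ) ^ 2) m2 V)⁻¹) x y‖
      ≤ (2 / κ) ^ 2 * ((Z.card : ℝ) ^ 2 * (4 * (((d : ℝ) + 1) * (L : ℝ) ^ 2 + a * D)))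
        * Real.exp (-(ctRate κ a d / L * Rx)) * Real.exp (-(ctRate κ a d / L * Ry)) := by
  have h := norm_blk_fullOpU_inv_sub_le_of_support_opNorm T M ha m2 hU hV hκ hcoU hcoV hL Z (blk_fullOpU_sub_eq_zero_of_agree T M a _ m2 Z hZ) x y hRx hRy
  refine h.trans (mul_le_mul_of_nonneg_right (mul_le_mul_of_nonneg_right (mul_le_mul_of_nonneg_left ?_ (by positivity)) (Real.exp_nonneg _)) (Real.exp_nonneg _))
  exact mul_le_mul_of_nonneg_left (l2_opNorm_fullOpU_sub_le_crude T M hD ha m2 hU hV) (sq_nonneg _)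

end Locality

end Summit.QuantumFields.YangMills.BalabanUVNodes.N15KingModelRung.CombesThomas

end
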